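/-
Copyright (c) 2026 the pub-hodgecm-mathlib formalisation cell (harness21).  Prover seat hodgecm-mathlib-K2E1-p12 (g0), Track B ∕ K2-LIT (build stream 29),
h413 = `stmt-HodgeConjecture-24833`, line `K2_E1_TraceFormulaBeta`, 5Res campaign, rung R8₂-sph (ROAD T′, step T9 ⇒ the (H4-b) exponent clause at the TRIVIAL `K`-type), dealer K2E1-plan (g6)
ruling (92)(i) 2026-09-04T10:46:12Z: the corollary of the spherical line into ★ `sig_K2E1ResidualCompactU2_of_exp`'s clause (`K2E1ResidualAdmissibleOfExponentsSmoothSigs` :45).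
-/
import Summits.HodgeConjecture.HodgeConjecture.Theorems.K2E1ResidualAdmissibleOfExponentsSmoothSigs   -- ★ `sig_K2E1ResidualCompactU2_of_exp` (the consumer clause, bytes of :45) and its whole currency
import Mathlib.MeasureTheory.Measure.OpenPos
import Mathlib.MeasureTheory.Function.LpSpace.Indicator
import HarnessLib

/-!
# K2·E1 — `K2E1ResidualSphericalExpClauseCMTwo` (R8₂-sph ⇒ (H4-b) AT THE TRIVIAL `K`-TYPE): IF THE `K`-FIXED RESIDUAL VECTORS ARE CONSTANT, THE EXPONENT CLAUSE OF ★ `sig_K2E1ResidualCompactU2_of_exp`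
# HOLDS FOR EVERY `K`-TYPE ON WHICH `K` ACTS TRIVIALLY, WITH `T := ℂ·1`

Track B ∕ K2-LIT, crux h413 = `stmt-HodgeConjecture-24833`, route of record `HCCMUnconditional`; cell `hodgecm-mathlib`, squad K2, ENGINE E1.  THEOREMS ONLY (no `def`, no `instance`, no
notation, no named-fact hypothesis, no `sorry`; default heartbeats); lane `--kind proof --supports stmt-HodgeConjecture-24833 --as helper` (count-neutral).

THE STEP (dealer (92)(i)).  ★ `K2E1ResidualAdmissibleOfExponentsSmoothSigs.sig_K2E1ResidualCompactU2_of_exp` :45 reduces the socket 5Res to the (H4-b) exponent package: for every compact `K →* U(Φ₂)(𝔸_{L⁺})`,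
Haar data `νN, 𝓕` and every irreducible finite-dimensional `K`-stable `E ≤ L²_res`, SOME finite-dimensional `T ≤ (G(𝔸) → ℂ)` contains the constant-term functions
`x ↦ ∫_{𝓕 i} ψ([x·u⁻¹]) dνN(u)` of every continuous representative `ψ` of every `w` in the `E`-isotypic part `homRangeSum`.  At the TRIVIAL `K`-type (binder `htriv`: `K` acts trivially on `E`)
the isotypic part consists of `K`-FIXED residual vectors (§1: every `K`-map out of a trivial module lands in the invariants), which the spherical line (★ T9 `K2E1ResidualSphericalLineCMTwoOfLetters`,
here the binder `hsph` in its `ιK`-form) makes CONSTANT: `w = c·𝟙`; a continuous `ψ` with `toLp ψ = c·𝟙` IS the constant `c` since an automorphic `μ` charges open sets (★ `IsAutomorphicMeasure` ⇒ `IsOpenPosMeasure`, `Continuous.ae_eq_iff_eq`), so every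
constant-term function is the constant `c·νN(𝓕 i)` and `T := ℂ ∙ 1` works (§2).

* §1 (any group `K`, any representation) **`homRangeSum_le_invariants_of_trivial`**: `τ` trivial ⇒ `homRangeSum ρ τ ≤ ρ.invariants`.
* §2 **`expClause_of_trivialKType_of_sphericalLine`** — the `∃ T`-clause of ★ :45 for every `E` with `K` acting trivially, from the single letter `hsph`.
HONEST LABEL: HC_CM is proved only modulo the 7 printed citations (2 remaining named inputs: hLiu418 = `stmt-HodgeConjecture-24832`, h413 = `stmt-HodgeConjecture-24833`) until rung 0
closes; this file asserts no named fact, closes no socket and crosses no ceiling by itself; count-neutral.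

## References
* [MoeglinWaldspurger1995] C. Mœglin, J.-L. Waldspurger, *Spectral Decomposition and Eisenstein Series* (1995), I.2.18 and V.3.13 (the residual spectrum; rank one).
* [Rogawski1990] J. D. Rogawski, *Automorphic Representations of Unitary Groups in Three Variables* (1990), §13.5 pp. 204–206.
* [WallachRRG1] N. Wallach, *Real Reductive Groups I* (1988), §1.4.7 (isotypic components).
-/

set_option autoImplicit false
-- the mandated namespace repeats `HodgeConjecture.HodgeConjecture`, as in every `Theorems/*.lean` of this sub-problem
set_option linter.dupNamespace false

noncomputable section

open MeasureTheory Measure Topology NumberField IsDedekindDomain Filter Submodule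
open Literature.NumberTheory.Automorphic Literature.NumberTheory.Automorphic.UnitaryGroup AdelicGroupData
open Summit.HodgeConjecture.HodgeConjecture.Cruxes.H413.K2E1CuspidalSpectrumUnitary

namespace Summit.HodgeConjecture.HodgeConjecture.Cruxes.H413.K2E1ResidualSphericalExpClauseCMTwo

/-! ## §1 `K`-maps out of a trivial `K`-module land in the invariants -/

/-- **THE ISOTYPIC PART OF A TRIVIAL `K`-MODULE CONSISTS OF `K`-FIXED VECTORS**: if `K` acts trivially on `W` (`τ k w = w`), every `K`-map `T : τ → ρ` has `ρ k (T w) = T (τ k w) = T w`, so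
★ `homRangeSum ρ τ ≤ ρ.invariants` (Mathlib `Representation.invariants`). [cite: WallachRRG1, §1.4.7] -/
theorem homRangeSum_le_invariants_of_trivial {K : Type*} [Group K] {V : Type*} [AddCommGroup V] [Module ℂ V] {W : Type*} [AddCommGroup W] [Module ℂ W]
    (ρ : Representation ℂ K V) (τ : Representation ℂ K W) (hτ : ∀ (k : K) (w : W), τ k w = w) :
    Representation.homRangeSum ρ τ ≤ ρ.invariants := by
  refine iSup_le fun T => ?_
  rintro _ ⟨w, rfl⟩
  refine (Representation.mem_invariants ρ _).2 fun k => ?_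
  have h := Representation.IntertwiningMap.isIntertwining τ ρ T k w
  rw [hτ k w] at h
  rw [Representation.IntertwiningMap.toLinearMap_apply]
  exact h.symm

/-! ## §2 The exponent clause of ★ `sig_K2E1ResidualCompactU2_of_exp` at a trivial `K`-type, from the spherical line -/

section CM

variable (L : Type) [Field L] [NumberField L] [IsCMField L]
  (μ : Measure (UnitaryGroup.cmDatum L 2 (Matrix.of fun i j : Fin 2 => if i.val + j.val + 1 = 2 then (1 : L) else 0)).automorphicQuotient)
  [(UnitaryGroup.cmDatum L 2 (Matrix.of fun i j : Fin 2 => if i.val + j.val + 1 = 2 then (1 : L) else 0)).IsAutomorphicMeasure μ]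

/-- **(H4-b) AT THE TRIVIAL `K`-TYPE FROM THE SPHERICAL LINE.**  Data as in ★ `sig_K2E1ResidualCompactU2_of_exp` :45: a group `K` with `ιK : K →* U(Φ₂)(𝔸_{L⁺})`, Haar data `νN i`, `𝓕 i` on the
radicals of ★ `cmParabolicData L 2`, a `K`-stable `E ≤ L²_res = cmResidualSubspace L 2 μ` ON WHICH `K` ACTS TRIVIALLY (`htriv`).  Letters: `hsph` = the spherical line in `ιK`-form («every
`ιK(K)`-fixed residual vector is a constant», ★ T9 `residual_fixed_mem_span_const_cm_two_of_letters` with `K_U := ιK.range` once its letters are paid); `μ` is positive on open sets by ★ `IsAutomorphicMeasure`.  CONCLUSION =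
the `∃ T`-clause of :45 VERBATIM for this `E`, with `T := ℂ ∙ 1`: every `w` of the `E`-isotypic part is `K`-fixed (§1), hence `c·𝟙`; a continuous representative is the constant `c`; its
constant terms are the constants `c·νN(𝓕 i)`. [cite: MoeglinWaldspurger1995, I.2.18 and V.3.13] [cite: Rogawski1990, §13.5] -/
theorem expClause_of_trivialKType_of_sphericalLine
    {K : Type} [Group K] (ιK : K →* (UnitaryGroup.cmDatum L 2 (Matrix.of fun i j : Fin 2 => if i.val + j.val + 1 = 2 then (1 : L) else 0)).Adelic)
    [∀ i, MeasurableSpace ((cmParabolicData L 2).radical i)]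
    (νN : ∀ i, Measure ((cmParabolicData L 2).radical i)) (𝓕 : ∀ i, Set ((cmParabolicData L 2).radical i))
    (hsph : ∀ v ∈ (cmResidualSubspace L 2 μ).toSubmodule,
      (∀ k : K, (UnitaryGroup.cmDatum L 2 (Matrix.of fun i j : Fin 2 => if i.val + j.val + 1 = 2 then (1 : L) else 0)).rightRegular μ (ιK k) v = v) →
        v ∈ ℂ ∙ (Lp.const 2 μ (1 : ℂ) : (UnitaryGroup.cmDatum L 2 (Matrix.of fun i j : Fin 2 => if i.val + j.val + 1 = 2 then (1 : L) else 0)).L2 μ))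
    (E : Submodule ℂ (cmResidualSubspace L 2 μ).toSubmodule) (hE : ∀ k, ∀ x ∈ E, ((cmResidualSubspace L 2 μ).toContRep.restrict ιK) k x ∈ E)
    (htriv : ∀ k, ∀ x ∈ E, ((cmResidualSubspace L 2 μ).toContRep.restrict ιK) k x = x) :
    ∃ T : Submodule ℂ ((UnitaryGroup.cmDatum L 2 (Matrix.of fun i j : Fin 2 => if i.val + j.val + 1 = 2 then (1 : L) else 0)).Adelic → ℂ), FiniteDimensional ℂ T ∧
      ∀ w ∈ Representation.homRangeSum ((cmResidualSubspace L 2 μ).toContRep.restrict ιK).toRepresentation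
          (((cmResidualSubspace L 2 μ).toContRep.restrict ιK).subRep E hE),
        ∀ ψ : (UnitaryGroup.cmDatum L 2 (Matrix.of fun i j : Fin 2 => if i.val + j.val + 1 = 2 then (1 : L) else 0)).automorphicQuotient → ℂ, Continuous ψ →
          ∀ hψ : MemLp ψ 2 μ, hψ.toLp ψ = ((w : (cmResidualSubspace L 2 μ).toSubmodule) :
              (UnitaryGroup.cmDatum L 2 (Matrix.of fun i j : Fin 2 => if i.val + j.val + 1 = 2 then (1 : L) else 0)).L2 μ) →
            ∀ i, (fun x => ∫ u in 𝓕 i, ψ ((UnitaryGroup.cmDatum L 2 (Matrix.of fun i j : Fin 2 => if i.val + j.val + 1 = 2 then (1 : L) else 0)).toAutomorphicQuotient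
              (x * (u : (UnitaryGroup.cmDatum L 2 (Matrix.of fun i j : Fin 2 => if i.val + j.val + 1 = 2 then (1 : L) else 0)).Adelic)⁻¹)) ∂(νN i)) ∈ T := by
  refine ⟨ℂ ∙ (fun _ => (1 : ℂ)), inferInstance, fun w hw ψ hψc hψ hψw i => ?_⟩
  -- the `E`-isotypic part is `K`-fixed (§1; `K` acts trivially on `E`)
  have hτ : ∀ (k : K) (e : E), (((cmResidualSubspace L 2 μ).toContRep.restrict ιK).subRep E hE) k e = e := fun k e =>
    Subtype.ext (htriv k e e.2)
  have hwinv := homRangeSum_le_invariants_of_trivial _ _ hτ hw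
  have hwK : ∀ k : K, (UnitaryGroup.cmDatum L 2 (Matrix.of fun i j : Fin 2 => if i.val + j.val + 1 = 2 then (1 : L) else 0)).rightRegular μ (ιK k)
      ((w : (cmResidualSubspace L 2 μ).toSubmodule) : (UnitaryGroup.cmDatum L 2 (Matrix.of fun i j : Fin 2 => if i.val + j.val + 1 = 2 then (1 : L) else 0)).L2 μ) =
        (w : (cmResidualSubspace L 2 μ).toSubmodule) := fun k =>
    congrArg Subtype.val ((Representation.mem_invariants _ _).1 hwinv k)
  -- hence `w = c • 𝟙`
  obtain ⟨c, hc⟩ := mem_span_singleton.1 (hsph _ (w : (cmResidualSubspace L 2 μ).toSubmodule).2 hwK)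
  -- a continuous representative of `c • 𝟙` is the constant `c`
  have hψae : ψ =ᵐ[μ] fun _ => c := by
    have h1 := hψ.coeFn_toLp
    rw [hψw, ← hc] at h1
    filter_upwards [h1, Lp.coeFn_smul c (Lp.const 2 μ (1 : ℂ) : (UnitaryGroup.cmDatum L 2 (Matrix.of fun i j : Fin 2 => if i.val + j.val + 1 = 2 then (1 : L) else 0)).L2 μ),
      Lp.coeFn_const (p := 2) (μ := μ) (c := (1 : ℂ))] with x hx1 hx2 hx3
    rw [← hx1, hx2, Pi.smul_apply, hx3, Function.const_apply, smul_eq_mul, mul_one]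
  have hψeq : ψ = fun _ => c := (Continuous.ae_eq_iff_eq μ hψc continuous_const).1 hψae
  -- the constant term of the constant `c` is the constant `c · νN(𝓕 i)`
  refine mem_span_singleton.2 ⟨(((νN i).real (𝓕 i) : ℝ) : ℂ) * c, funext fun x => ?_⟩
  simp only [hψeq, setIntegral_const, Pi.smul_apply, smul_eq_mul, mul_one, Complex.real_smul]

end CM

end Summit.HodgeConjecture.HodgeConjecture.Cruxes.H413.K2E1ResidualSphericalExpClauseCMTwo

end
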